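import Summits.Ventures.HSemireg.WedgeHankelSiegelIdealSpikeTest

/-!
# Venture HSemireg — THE PROJECTIONS ONTO THE DOLBEAULT BLOCKS of th-7's model: `prj a b : ⋀ → plane(a,b)`, `θ = Σ_{a+b=k} prj a b θ` on `⋀^k`,
# and two consequences in projection form: the SIEGEL IDEAL IS BIGRADED, and THE KERNEL OF A BIHOMOGENEOUS CLASS IS BIGRADED

HONEST FRAMING. Part of the Lean index of the computation cell `pub-hsemireg` (seat p10 gen 15, Sunday typer «UNIFORM-IN-n»).
Finite-dimensional EXTERIOR ALGEBRA over a field (plus polynomials in one central variable) ONLY: no variety, no cohomology theory, no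
sheaf, no Ext group, no semiregularity map; nothing here says that HC / HC_CM / HC_AV holds; no Literature fact is declared or used.
Custodian versions as in `WedgeHankelSiegelIdeal` (1/3): FORMULA-N PART A §2.6 THEOREM H / §4.1″ (the Dolbeault blocks `H^b(⋀^a T)` of
`HT^k`); STRUCTURE.md v1.0-SIGNED 9b196a05977dd067 §1.1.  The dictionary (`x_a ↔ ∂_a`, `y_a ↔ dz̄_a`; `plane(a,b) ↔ H^b(⋀^a T)`;
`θ ↦ θ ∧ w_n(q) ↔ ⌟v`) is QUOTED, never asserted.

WHAT IS IN THE TREE / KEYED.  Gen 11's `WedgeHankelSiegelIdealPlanes` (row 677) defines the `(a,b)`-PLANES and their isotropic parts;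
`…BlockSum` (698) / `…SpikeTest` (705) prove that `⋀^k` is the sum of its blocks (`exteriorPower_le_sup_plane`), that blocks with different
`x`-counts are disjoint (`disjoint_plane_sup`, `eq_zero_of_sum_eq_zero` for block FAMILIES `θ : ℕ → ⋀`), that planes multiply into planes
(`mul_mem_plane`), and that `SI_k = Σ_a (plane(a,k−a) ∩ SI_k)` (`siegelIdeal_eq_sup_blocks'`).  THIS FILE (continues namespace
`Summit.Ventures.HSemireg.Wedge.HankelSiegelIdeal`; imports (10) = `…SpikeTest`) adds the ELEMENT-LEVEL form the confluent kernel law needs —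
canonical components of a single `θ`, not a chosen block family:
* §17a the type `(|Pof s|, |Qof s|)` of a monomial support ((2)'s `Pof`/`Qof`; `Pof_xs_union_ys`, `Qof_xs_union_ys`, `B_mem_plane`); off-type
  coordinates of a plane element vanish (`coord_eq_zero_of_mem_plane`); **`eq_zero_of_mem_plane_of_mem_plane`: two different planes meet in `0`**
  (also for equal `x`-count and different `y`-count), `disjoint_plane`.
* §17b **THE PROJECTIONS `prj a b`** (`Basis.constr` on the monomial basis: keep the monomials of type `(a,b)`): `prj_mem_plane`, identity on
  `plane(a,b)` (`prj_of_mem_plane`), zero on every other plane (`prj_of_mem_plane_ne`), **`sum_prj`: `θ = Σ_{a ≤ k} prj a (k−a) θ` for `θ ∈ ⋀^k`**,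
  `iSup_plane_eq_exteriorPower` (equality form of (10)'s `exteriorPower_le_sup_plane`), `prj_eq_zero_of_ne`; `mul_w_spike_mem_plane`.
* §17c **`prj_mem_siegelIdeal`: `θ ∈ SI_k ⇒ prj a (k−a) θ ∈ SI_k`** (projection form of (9)'s bihomogeneity; proved independently through the
  symmetrisation: `sym` sends `plane(a,b)` into `t`-degree exactly `b`, `coeff_sym_eq_zero_of_mem_plane`, and `SI_k = ker(sym ∣ ⋀^k)` by (3/3)).
* §17d **`mul_eq_zero_iff_forall_prj_mul_eq_zero`: for `f ∈ plane(c,d)` and `θ ∈ ⋀^k`, `θ ∧ f = 0 ⟺ prj a (k−a) θ ∧ f = 0` for all `a ≤ k`**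
  (element form of (10)'s `block_mul_spike_eq_zero`, for any bihomogeneous `f`); `mul_w_spike_eq_zero_iff`.
NOT typed here: the kernels themselves (sequel `WedgeHankelConfluent`: classes of bounded order at a node — the confluent faces); anything Ext-side.
Class side only.
-/

open Module

namespace Summit.Ventures.HSemireg.Wedge.HankelSiegelIdeal

open Summit.Ventures.HSemireg.Wedge Summit.Ventures.HSemireg.Wedge.Hankel
  Summit.Ventures.HSemireg.Wedge.HankelSiegel

variable (K : Type*) [Field K] {n : ℕ}

/-! ## §17a. The type of a monomial support ((2)'s `Pof`, `Qof`) -/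

omit [Field K] in
/-- membership in the `x`-part `Pof`. -/
@[simp] lemma mem_Pof {s : Finset (In n)} {a : Fin n} : a ∈ Pof s ↔ Fin.castAdd n a ∈ s := by simp [Pof]

omit [Field K] in
/-- membership in the `y`-part `Qof`. -/
@[simp] lemma mem_Qof {s : Finset (In n)} {a : Fin n} : a ∈ Qof s ↔ Fin.natAdd n a ∈ s := by simp [Qof]

omit [Field K] in
/-- the `x`-part of `xs P ∪ ys Q` is `P`. -/
@[simp] lemma Pof_xs_union_ys (P Q : Finset (Fin n)) : Pof (xs P ∪ ys Q) = P := by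
  ext a; rw [mem_Pof, Finset.mem_union, castAdd_mem_xs]
  exact ⟨fun h => h.resolve_right (castAdd_notMem_ys a Q), Or.inl⟩

omit [Field K] in
/-- the `y`-part of `xs P ∪ ys Q` is `Q`. -/
@[simp] lemma Qof_xs_union_ys (P Q : Finset (Fin n)) : Qof (xs P ∪ ys Q) = Q := by
  ext a; rw [mem_Qof, Finset.mem_union, natAdd_mem_ys]
  exact ⟨fun h => h.resolve_left (natAdd_notMem_xs a P), Or.inr⟩

/-- the monomial of a support is the plane monomial of its type. -/
lemma B_eq_pmon (s : Finset (In n)) :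
    B K (In n) s = pmon K ((⟨Pof s, rfl⟩, ⟨Qof s, rfl⟩) : PIdx n (Pof s).card (Qof s).card) := by
  rw [pmon]; exact congrArg _ (xs_union_ys s).symm

/-- a monomial whose type is `(a,b)` lies in `plane(a,b)`. -/
lemma B_mem_plane {s : Finset (In n)} {a b : ℕ} (ha : (Pof s).card = a) (hb : (Qof s).card = b) : B K (In n) s ∈ plane K n a b := by
  subst ha; subst hb
  rw [B_eq_pmon]; exact Submodule.subset_span ⟨_, rfl⟩

/-- **OFF-TYPE COORDINATES OF A PLANE ELEMENT VANISH**: for `z ∈ plane(a,b)` and a support `s` of type `≠ (a,b)`, `coord_s z = 0`. -/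
lemma coord_eq_zero_of_mem_plane {a b : ℕ} {z : HT K (In n)} (hz : z ∈ plane K n a b) {s : Finset (In n)}
    (hs : (Pof s).card ≠ a ∨ (Qof s).card ≠ b) : (B K (In n)).coord s z = 0 := by
  classical
  rw [plane] at hz
  induction hz using Submodule.span_induction with
  | mem x hx =>
    obtain ⟨⟨⟨P, hP⟩, ⟨Q, hQ⟩⟩, rfl⟩ := hx
    rw [pmon, Basis.coord_apply, Basis.repr_self, Finsupp.single_apply, if_neg]
    rintro rfl
    simp only [Pof_xs_union_ys, Qof_xs_union_ys] at hs
    exact hs.elim (fun h => h hP) (fun h => h hQ)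
  | zero => simp
  | add x y _ _ hx hy => rw [map_add, hx, hy, add_zero]
  | smul c x _ hx => rw [map_smul, hx, smul_zero]

/-- **TWO DIFFERENT PLANES MEET IN `0`**: `z ∈ plane(a,b) ∩ plane(a′,b′)` with `(a,b) ≠ (a′,b′)` is zero. -/
theorem eq_zero_of_mem_plane_of_mem_plane {a b a' b' : ℕ} (h : a ≠ a' ∨ b ≠ b') {z : HT K (In n)} (hz : z ∈ plane K n a b)
    (hz' : z ∈ plane K n a' b') : z = 0 := by
  apply (B K (In n)).repr.injective
  rw [map_zero]
  ext s
  by_cases hs : (Pof s).card = a ∧ (Qof s).card = b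
  · exact coord_eq_zero_of_mem_plane K hz' (by omega)
  · exact coord_eq_zero_of_mem_plane K hz (by tauto)

/-- different planes are disjoint submodules. -/
theorem disjoint_plane {a b a' b' : ℕ} (h : a ≠ a' ∨ b ≠ b') : Disjoint (plane K n a b) (plane K n a' b') := by
  rw [Submodule.disjoint_def]
  exact fun z hz hz' => eq_zero_of_mem_plane_of_mem_plane K h hz hz'

/-! ## §17b. The projections onto the planes and the grading `⋀^k = ⊕_{a+b=k} plane(a,b)` -/

/-- **THE PROJECTION ONTO THE `(a,b)`-PLANE**: keep the monomials of type `(a,b)`, kill the others. -/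
noncomputable def prj (n a b : ℕ) : HT K (In n) →ₗ[K] HT K (In n) :=
  (B K (In n)).constr K fun s => if (Pof s).card = a ∧ (Qof s).card = b then B K (In n) s else 0

/-- the projection on a monomial. -/
lemma prj_B (a b : ℕ) (s : Finset (In n)) :
    prj K n a b (B K (In n) s) = if (Pof s).card = a ∧ (Qof s).card = b then B K (In n) s else 0 := by
  rw [prj, Basis.constr_basis]

/-- **`prj a b θ ∈ plane(a,b)` for every `θ`.** -/
theorem prj_mem_plane (a b : ℕ) (θ : HT K (In n)) : prj K n a b θ ∈ plane K n a b := by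
  rw [← (B K (In n)).sum_repr θ, map_sum]
  refine Submodule.sum_mem _ fun s _ => ?_
  rw [map_smul, prj_B]
  refine Submodule.smul_mem _ _ ?_
  split_ifs with h
  · exact B_mem_plane K h.1 h.2
  · exact Submodule.zero_mem _

/-- **the projection is the IDENTITY on its plane.** -/
theorem prj_of_mem_plane {a b : ℕ} {z : HT K (In n)} (hz : z ∈ plane K n a b) : prj K n a b z = z := by
  rw [plane] at hz
  induction hz using Submodule.span_induction with
  | mem x hx =>
    obtain ⟨⟨⟨P, hP⟩, ⟨Q, hQ⟩⟩, rfl⟩ := hx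
    rw [pmon, prj_B, if_pos]
    simp only [Pof_xs_union_ys, Qof_xs_union_ys]; exact ⟨hP, hQ⟩
  | zero => rw [map_zero]
  | add x y _ _ hx hy => rw [map_add, hx, hy]
  | smul c x _ hx => rw [map_smul, hx]

/-- **the projection KILLS every other plane.** -/
theorem prj_of_mem_plane_ne {a b a' b' : ℕ} (h : a ≠ a' ∨ b ≠ b') {z : HT K (In n)} (hz : z ∈ plane K n a' b') :
    prj K n a b z = 0 := by
  rw [plane] at hz
  induction hz using Submodule.span_induction with
  | mem x hx =>
    obtain ⟨⟨⟨P, hP⟩, ⟨Q, hQ⟩⟩, rfl⟩ := hx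
    rw [pmon, prj_B, if_neg]
    simp only [Pof_xs_union_ys, Qof_xs_union_ys]
    omega
  | zero => rw [map_zero]
  | add x y _ _ hx hy => rw [map_add, hx, hy, add_zero]
  | smul c x _ hx => rw [map_smul, hx, smul_zero]

/-- the projections of a monomial of degree `k` over the planes `(a, k−a)` add up to the monomial. -/
lemma sum_prj_B {k : ℕ} {s : Finset (In n)} (hs : s.card = k) :
    ∑ a ∈ Finset.range (k + 1), prj K n a (k - a) (B K (In n) s) = B K (In n) s := by
  have hk : (Pof s).card + (Qof s).card = k := by rw [card_Pof_add_card_Qof, hs]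
  have h1 : ∀ a ∈ Finset.range (k + 1), prj K n a (k - a) (B K (In n) s) = if a = (Pof s).card then B K (In n) s else 0 := by
    intro a ha
    rw [prj_B]
    by_cases h : a = (Pof s).card
    · rw [if_pos h, if_pos ⟨h.symm, by omega⟩]
    · rw [if_neg h, if_neg (by omega)]
  rw [Finset.sum_congr rfl h1, Finset.sum_ite_eq', if_pos (Finset.mem_range.mpr (by omega))]

/-- **THE GRADING: `θ = Σ_{a ≤ k} prj a (k−a) θ` for every `θ ∈ ⋀^k`.** -/
theorem sum_prj {k : ℕ} {θ : HT K (In n)} (hθ : θ ∈ ⋀[K]^k (In n → K)) :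
    ∑ a ∈ Finset.range (k + 1), prj K n a (k - a) θ = θ := by
  rw [exteriorPower_eq_Hom_univ, Hom] at hθ
  induction hθ using Submodule.span_induction with
  | mem x hx => obtain ⟨s, ⟨-, hs⟩, rfl⟩ := hx; exact sum_prj_B K hs
  | zero => simp
  | add x y _ _ hx hy => simp only [map_add, Finset.sum_add_distrib, hx, hy]
  | smul c x _ hx => simp only [map_smul, ← Finset.smul_sum, hx]

/-- `⋀^k ≤ Σ_{a ≤ k} plane(a, k−a)`. -/
theorem exteriorPower_le_iSup_plane (k : ℕ) :
    (⋀[K]^k (In n → K) : Submodule K (HT K (In n))) ≤ ⨆ a : Fin (k + 1), plane K n a (k - a) := by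
  intro θ hθ
  rw [← sum_prj K hθ]
  refine Submodule.sum_mem _ fun a ha => ?_
  rw [Finset.mem_range] at ha
  exact Submodule.mem_iSup_of_mem (⟨a, ha⟩ : Fin (k + 1)) (prj_mem_plane K a (k - a) θ)

/-- **`⋀^k = Σ_{a ≤ k} plane(a, k−a)`** (the Dolbeault grading of `HT^k` in the quoted dictionary). -/
theorem iSup_plane_eq_exteriorPower (k : ℕ) :
    (⨆ a : Fin (k + 1), plane K n a (k - a)) = ⋀[K]^k (In n → K) := by
  refine le_antisymm (iSup_le fun a => ?_) (exteriorPower_le_iSup_plane K k)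
  have := plane_le_exteriorPower K (n := n) a (k - a)
  rwa [show (a : ℕ) + (k - a) = k by have := a.2; omega] at this

/-- the components of `θ ∈ ⋀^k` off the diagonal `a + b = k` vanish: `prj a b θ = 0` unless `a + b = k`. -/
lemma prj_eq_zero_of_ne {k a b : ℕ} (h : a + b ≠ k) {θ : HT K (In n)} (hθ : θ ∈ ⋀[K]^k (In n → K)) : prj K n a b θ = 0 := by
  rw [← sum_prj K hθ, map_sum]
  refine Finset.sum_eq_zero fun c hc => ?_
  rw [Finset.mem_range] at hc
  exact prj_of_mem_plane_ne K (by omega) (prj_mem_plane K c (k - c) θ)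

/-- `θ ∧ E_p ∈ plane(a + (n−p), b + p)` for `θ ∈ plane(a,b)`, `p ≤ n` (`E_p = w_n(δ_p) ∈ plane(n−p, p)`). -/
theorem mul_w_spike_mem_plane {a b p : ℕ} (hp : p ≤ n) {θ : HT K (In n)} (hθ : θ ∈ plane K n a b) :
    θ * w K n n (fun j => if j = p then (1 : K) else 0) ∈ plane K n (a + (n - p)) (b + p) :=
  mul_mem_plane K hθ (w_spike_mem_plane K le_rfl hp)

/-! ## §17c. The Siegel ideal is bigraded (projection form) -/

/-- `sym` sends `plane(a,b)` into `t`-degree exactly `b`: every other coefficient of `sym z` vanishes. -/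
lemma coeff_sym_eq_zero_of_mem_plane {a b : ℕ} {z : HT K (In n)} (hz : z ∈ plane K n a b) {j : ℕ} (hj : j ≠ b) :
    (sym K z).coeff j = 0 := by
  have h := sym_mem_tspan_of_mem_plane K hz
  rw [tspan] at h
  generalize sym K z = y at h
  induction h using Submodule.span_induction with
  | mem x hx =>
    obtain ⟨S, rfl⟩ := hx
    rw [Polynomial.coeff_monomial, if_neg (Ne.symm hj)]
  | zero => simp
  | add x y _ _ hx hy => rw [Polynomial.coeff_add, hx, hy, add_zero]
  | smul c x _ hx => rw [Polynomial.coeff_smul, hx, smul_zero]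

/-- a plane element whose `sym` has vanishing `b`-th coefficient has `sym = 0`. -/
lemma sym_eq_zero_of_coeff {a b : ℕ} {z : HT K (In n)} (hz : z ∈ plane K n a b) (h : (sym K z).coeff b = 0) : sym K z = 0 := by
  ext j
  by_cases hj : j = b
  · rw [hj, h, Polynomial.coeff_zero]
  · rw [coeff_sym_eq_zero_of_mem_plane K hz hj, Polynomial.coeff_zero]

/-- **THE SIEGEL IDEAL IS BIGRADED: `θ ∈ SI_k ⇒ prj a (k−a) θ ∈ SI_k` for every `a`.** -/
theorem prj_mem_siegelIdeal {k : ℕ} {θ : HT K (In n)} (hθ : θ ∈ siegelIdeal K n k) (a : ℕ) :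
    prj K n a (k - a) θ ∈ siegelIdeal K n k := by
  have hθk : θ ∈ ⋀[K]^k (In n → K) := siegelIdeal_le_exteriorPower K k hθ
  by_cases ha : a ≤ k
  swap
  · rw [prj_eq_zero_of_ne K (by omega) hθk]; exact Submodule.zero_mem _
  -- sym θ = 0, read in t-degree k − a: only the component of type (a, k−a) contributes
  have hsum := congrArg (fun x => (sym K x).coeff (k - a)) (sum_prj K hθk)
  simp only [map_sum, Polynomial.finsetSum_coeff, sym_eq_zero_of_mem_siegelIdeal K hθ, Polynomial.coeff_zero] at hsum
  rw [Finset.sum_eq_single a] at hsum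
  · have hz : sym K (prj K n a (k - a) θ) = 0 := sym_eq_zero_of_coeff K (prj_mem_plane K a (k - a) θ) hsum
    have hmem : prj K n a (k - a) θ ∈ ⋀[K]^k (In n → K) := by
      have := plane_le_exteriorPower K (n := n) a (k - a) (prj_mem_plane K a (k - a) θ)
      rwa [show a + (k - a) = k by omega] at this
    have hker : (⟨prj K n a (k - a) θ, hmem⟩ : ⋀[K]^k (In n → K)) ∈ LinearMap.ker (symk K n k) := by
      rw [LinearMap.mem_ker, symk, LinearMap.comp_apply, Submodule.subtype_apply]; exact hz
    rw [ker_symk_eq_siegelIdeal] at hker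
    exact hker
  · intro c hc hca
    rw [Finset.mem_range] at hc
    exact coeff_sym_eq_zero_of_mem_plane K (prj_mem_plane K c (k - c) θ) (by omega)
  · intro h; exact absurd (Finset.mem_range.mpr (by omega)) h

/-! ## §17d. The kernel of a bihomogeneous class is bigraded (projection form) -/

/-- **A BIHOMOGENEOUS CLASS IS KILLED BY `θ ∈ ⋀^k` IFF IT IS KILLED BY EVERY COMPONENT OF `θ`**: for `f ∈ plane(c,d)`,
`θ ∧ f = 0 ⟺ ∀ a ≤ k, prj a (k−a) θ ∧ f = 0` (the products `prj a (k−a) θ ∧ f` lie in the pairwise different planes `(a+c, k−a+d)`). -/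
theorem mul_eq_zero_iff_forall_prj_mul_eq_zero {c d k : ℕ} {f : HT K (In n)} (hf : f ∈ plane K n c d) {θ : HT K (In n)}
    (hθ : θ ∈ ⋀[K]^k (In n → K)) : θ * f = 0 ↔ ∀ a ≤ k, prj K n a (k - a) θ * f = 0 := by
  constructor
  · intro h a ha
    -- project θ ∧ f = Σ_c prj c (k−c) θ ∧ f onto the plane (a + c, k − a + d)
    have hsum : ∑ e ∈ Finset.range (k + 1), prj K n e (k - e) θ * f = 0 := by rw [← Finset.sum_mul, sum_prj K hθ, h]
    have hp := congrArg (prj K n (a + c) (k - a + d)) hsum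
    rw [map_sum, map_zero, Finset.sum_eq_single a] at hp
    · rwa [prj_of_mem_plane K (mul_mem_plane K (prj_mem_plane K a (k - a) θ) hf)] at hp
    · intro e he hea
      rw [Finset.mem_range] at he
      exact prj_of_mem_plane_ne K (by omega) (mul_mem_plane K (prj_mem_plane K e (k - e) θ) hf)
    · intro hn; exact absurd (Finset.mem_range.mpr (by omega)) hn
  · intro h
    rw [← sum_prj K hθ, Finset.sum_mul]
    exact Finset.sum_eq_zero fun a ha => h a (by rw [Finset.mem_range] at ha; omega)

/-- the same for the powers: `θ ∧ E_p = 0 ⟺ prj a (k−a) θ ∧ E_p = 0` for all `a ≤ k` (`θ ∈ ⋀^k`, `p ≤ n`). -/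
theorem mul_w_spike_eq_zero_iff {k p : ℕ} (hp : p ≤ n) {θ : HT K (In n)} (hθ : θ ∈ ⋀[K]^k (In n → K)) :
    θ * w K n n (fun j => if j = p then (1 : K) else 0) = 0 ↔
      ∀ a ≤ k, prj K n a (k - a) θ * w K n n (fun j => if j = p then (1 : K) else 0) = 0 :=
  mul_eq_zero_iff_forall_prj_mul_eq_zero K (w_spike_mem_plane K le_rfl hp) hθ

end Summit.Ventures.HSemireg.Wedge.HankelSiegelIdeal
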